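import Literature.NumberTheory.EllipticCurves.ZpExtensionEisensteinDVRSetting
import Literature.NumberTheory.EllipticCurves.DivisionTowerH1VanishingOfHomothetyProofs
import Literature.NumberTheory.EllipticCurves.HeegnerPointsKolyvaginPairing
import Literature.NumberTheory.EllipticCurves.KummerImageIsotropyProofs
import Literature.NumberTheory.EllipticCurves.Kato2004.IwasawaH1ReductionInfty
import Literature.NumberTheory.EllipticCurves.HeegnerPointsKolyvaginCebotarevProofs
import Literature.NumberTheory.GaloisRepresentations.ResSubgroupInjectiveOfInterProofs
import HarnessLib

/-!
# Howard's H.2 for the Eisenstein tower of an elliptic curve: the `H2Tower` field of `SatisfiesH`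
# (theorems only; no definition, no named fact, no instance, no `sorry`)

Topic `NumberTheory/EllipticCurves` (D1 road of cell `pub/bsd-print-x9`; v9/v3 STUB 1 of the shared μ-crux, field
`SatisfiesH.h2` of `W.eisensteinDVRSetting[Tame]` — the hypothesis `h2` of
`WeierstrassCurve.eisensteinDVRSettingTame_satisfiesH_of`).

Howard 2004, Hypothesis H.2: «There is a Galois extension `F/ℚ` such that `K ⊂ F`, `G_F` acts trivially on `T`, and
`H¹(F(μ_{p^∞})/K, T̄) = 0`» (arXiv:1202.6340 p. 7, L61–63), typed for the compact tower `T = T_𝔮` as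
`Howard2004.AdicTower.H2Tower`: a CLOSED NORMAL subgroup `Γ_F ≤ Γ_K`, stable under the conjugation datum, acting
trivially on every level `T_𝔮/p^{k+1} = E_K[p^{k+1}] ⊗ A_{m,k+1}(ψ)`, with `H¹(Γ_K, E_K[p]) → H¹(Γ_F ∩ Γ_{K(μ_{p^∞})},
E_K[p])` injective.  Here:

* `Γ_F := (⋂_N Γ_{K(E[p^{N+1}])}) ∩ Gal(K̄/K_∞)` (`F = K_∞ · K(E[p^∞])`): closed, normal; acting trivially on the
  levels (`ZpExtension.eisensteinTwist_apply_eq_self_of_mem_kerSubgroup`); stable under `cd.conj` as soon as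
  `Gal(K̄/K_∞)` is (hypothesis `hconj` — for an anticyclotomic `κ` and `cd.τ` a transported complex conjugation this
  is Greenberg's «`c` acts on `Gal(K_∞/K)` by `−1`»; the torsion part by `IsLiftOfAut.conjGalCMH_mem_torsionFixing`).
* INJECTIVITY: the finite-layer form in the tree (`LawsonWuthrich2016.subgroupResKer_geomTorsion_prime_eq_bot_of_
  homothety_layer`: `res` to every open normal `U ⊇ Γ_{K(E[p^{m+1}])} ∩ Gal(K̄/K_N)` is injective on `H¹(K, E_K[p])`,
  from ONE homothety `z ≡ a` on `E_K[p]` with `p ∤ a − 1` — Serre/Gross, in the tree for the frames of the crux as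
  `exists_smul_eq_zsmul_of_thm413Hypotheses`) + the compactness step
  `DiscreteGaloisModule.resSubgroup_one_eq_zero_of_iInf_le` along `U_N := Γ_{K(E[p^{N+1}])} ∩ Gal(K̄/K_N)`, whose
  intersection lies in `Γ_F ∩ Γ_{K(μ_{p^∞})}` because **`K(E[p^n]) ⊇ μ_{p^n}`** — the Weil pairing takes a primitive
  `p^n`-th root of unity as a value (`exists_isPrimitiveRoot_weilPairingFun`) and is Galois-equivariant
  (`weilPairingFun_smul`): `WeierstrassCurve.torsionFixing_le_ker_mu`.

Main result: **`WeierstrassCurve.eisensteinTower_h2Tower_of_homothety`**.  Cell `pub/bsd-print-x9`; seat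
`bsd-line-x10b-p1-w7` g0.  No summit statement is proved; BSD is not proved by any of this.

References: B. Howard, Compositio Math. 140 (2004), §1.3 H.2 (arXiv:1202.6340 p. 7, L61–63), Lemma 2.6.2;
T. Lawson, C. Wuthrich, *Vanishing of some Galois cohomology groups for elliptic curves* (2016), Lemma 3–4;
J. H. Silverman, *AEC* (2009), III.8.1, Cor. III.8.1.1; J.-P. Serre, *Galois Cohomology* (1997), I §2.2.
-/

set_option autoImplicit false

noncomputable section

open Function NumberField IsDedekindDomain Field
open scoped NumberField ContRepresentation Classical

universe u

/-! ## §1 `K(E[n]) ⊇ μ_n`: `Γ_{K(E[n])}` acts trivially on `μ_n` -/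

namespace WeierstrassCurve

open Literature.NumberTheory.EllipticCurves Literature.NumberTheory.GaloisRepresentations
open Literature.NumberTheory.GaloisRepresentations.DiscreteGaloisModule (mu MuCarrier)

section Weil

variable {F : Type u} [Field F] (W : WeierstrassCurve F)

/-- `E[a] ⊆ E[a·b]`, so **`Γ_{F(E[a·b])} ≤ Γ_{F(E[a])}`**. [cite: SilvermanAEC2009, III §7 (the tower of division fields)] -/
theorem torsionFixing_mul_le (a b : ℤ) : torsionFixing W (a * b) ≤ torsionFixing W a := by
  intro σ hσ
  refine (mem_torsionFixing_iff W a).mpr fun P ↦ ?_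
  have hP : (P : geomPoints W) ∈ geomTorsion W (a * b) := by
    refine (mem_geomTorsion_iff _ _ _).mpr ?_
    rw [mul_comm, mul_zsmul, (mem_geomTorsion_iff _ _ _).mp P.2, zsmul_zero]
  have h := smul_eq_of_mem_torsionFixing W (a * b) hσ ⟨P, hP⟩
  exact Subtype.ext (by simpa only [AddSubgroup.torsionBy.coe_smul] using congrArg Subtype.val h)

/-- **`Γ_{F(E[p^{n+1}])} ≤ Γ_{F(E[p^n])}`**. [cite: SilvermanAEC2009, III §7] -/
theorem torsionFixing_pow_succ_le (q : ℤ) (n : ℕ) : torsionFixing W (q ^ (n + 1)) ≤ torsionFixing W (q ^ n) := by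
  rw [pow_succ]
  exact torsionFixing_mul_le W _ _

/-- **`K(E[n]) ⊇ μ_n`: an element of `Γ_F` fixing `E[n]` pointwise fixes every `n`-th root of unity**
(`n` invertible in `F`): the Weil pairing takes a PRIMITIVE `n`-th root of unity `ζ₀ = e_n(P₀, Q₀)` as a value
(Cor. III.8.1.1) and `σ ζ₀ = e_n(σP₀, σQ₀) = ζ₀` (Prop. III.8.1(d)); every `n`-th root of unity is a power of `ζ₀`.
[cite: SilvermanAEC2009, Prop. III.8.1(d) and Cor. III.8.1.1] -/
theorem torsionFixing_le_ker_mu [W.IsElliptic] {n : ℕ} (hn : (n : F) ≠ 0) :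
    torsionFixing W (n : ℤ) ≤ (mu F n).ker := by
  haveI : NeZero n := ⟨fun h ↦ hn (by rw [h, Nat.cast_zero])⟩
  intro σ hσ
  obtain ⟨P₀, hP₀⟩ := exists_addOrderOf_eq (W := W) hn
  obtain ⟨Q₀, hζ₀⟩ := exists_isPrimitiveRoot_weilPairingFun (W := W) hn hP₀
  set ζ₀ := weilPairingFun hn (P₀ : W.geomPoints) (Q₀ : W.geomPoints) with hζ₀def
  -- `σ` fixes `ζ₀`
  have hfix : σ • ζ₀ = ζ₀ := by
    rw [hζ₀def, ← weilPairingFun_smul hn σ (zsmul_coe_geomTorsion P₀) (zsmul_coe_geomTorsion Q₀)]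
    have hP := congrArg Subtype.val (smul_eq_of_mem_torsionFixing W (n : ℤ) hσ P₀)
    have hQ := congrArg Subtype.val (smul_eq_of_mem_torsionFixing W (n : ℤ) hσ Q₀)
    rw [AddSubgroup.torsionBy.coe_smul] at hP hQ
    rw [hP, hQ]
  -- hence every `n`-th root of unity
  rw [ContinuousRep.mem_ker]
  refine LinearMap.ext fun ζ ↦ muFieldVal_injective ?_
  rw [LinearMap.id_apply]
  change muFieldVal (mu F n σ ζ) = muFieldVal ζ
  rw [muFieldVal_mu_apply]
  have hζn : muFieldVal ζ ^ n = 1 := by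
    have h := ((MuCarrier.toAdditive ζ).toMul : rootsOfUnity n (AlgebraicClosure F)).2
    rw [mem_rootsOfUnity] at h
    change (((MuCarrier.toAdditive ζ).toMul : rootsOfUnity n (AlgebraicClosure F)) :
      (AlgebraicClosure F)ˣ).val ^ n = 1
    rw [← Units.val_pow_eq_pow_val, h, Units.val_one]
  obtain ⟨i, -, hi⟩ := hζ₀.eq_pow_of_pow_eq_one hζn
  rw [← hi, smul_pow', hfix]

end Weil

/-! ## §2 The H2Tower field for the curve's Eisenstein tower -/

section H2

open Literature.NumberTheory.GaloisCohomology.Howard2004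
open Literature.NumberTheory.EllipticCurves.ZpExtension (EisensteinLevel)

variable {K : Type} [Field K] [NumberField K] (W : WeierstrassCurve ℚ) [W.IsElliptic] {p : ℕ} [hp : Fact p.Prime]
  (κ : ZpExtension K p) {m : ℕ} (hm : 1 ≤ m) (cd : ConjugationDatum K)

/-- The subgroup `Γ_F := (⋂_N Γ_{K(E[p^{N+1}])}) ∩ Gal(K̄/K_∞)` of `Γ_K` (`F = K_∞·K(E[p^∞])`) is CLOSED.
[cite: Howard2004HeegnerKolyvagin, §1.3 H.2 (arXiv p. 7, L61–63)] -/
theorem isClosed_iInf_torsionFixing_inf_kerSubgroup :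
    IsClosed (((⨅ N : ℕ, torsionFixing (W.baseChange K) ((p : ℤ) ^ (N + 1))) ⊓ κ.kerSubgroup :
      Subgroup (absoluteGaloisGroup K)) : Set (absoluteGaloisGroup K)) := by
  rw [Subgroup.coe_inf, Subgroup.coe_iInf]
  refine IsClosed.inter (isClosed_iInter fun N ↦ ?_) κ.isClosed_kerSubgroup
  exact Subgroup.isClosed_of_isOpen _ (isOpen_torsionFixing (W.baseChange K)
    (pow_ne_zero _ (Int.natCast_ne_zero.mpr hp.out.ne_zero)))

omit [W.IsElliptic] in
/-- `Γ_F` is NORMAL in `Γ_K`. [cite: Howard2004HeegnerKolyvagin, §1.3 H.2 (arXiv p. 7, L61–63)] -/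
theorem normal_iInf_torsionFixing_inf_kerSubgroup :
    ((⨅ N : ℕ, torsionFixing (W.baseChange K) ((p : ℤ) ^ (N + 1))) ⊓ κ.kerSubgroup :
      Subgroup (absoluteGaloisGroup K)).Normal := by
  haveI : (⨅ N : ℕ, torsionFixing (W.baseChange K) ((p : ℤ) ^ (N + 1))).Normal :=
    ⟨fun g hg h ↦ Subgroup.mem_iInf.mpr fun N ↦
      (torsionFixing_normal (W.baseChange K) _).conj_mem g (Subgroup.mem_iInf.mp hg N) h⟩
  haveI : κ.kerSubgroup.Normal := by
    change κ.toContinuousMonoidHom.toMonoidHom.ker.Normal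
    infer_instance
  infer_instance

/-- **Howard's H.2 (`H2Tower`) for the Eisenstein tower `T^{(k)} = E_K[p^{k+1}] ⊗ A_{m,k+1}(ψ)` of `E_K`**, from
ONE homothety `z ≡ a` on `E_K[p]` with `p ∤ a − 1` and the `cd.conj`-stability of `Gal(K̄/K_∞)`: with
`Γ_F := (⋂_N Γ_{K(E[p^{N+1}])}) ∩ Gal(K̄/K_∞)` — closed, normal, `cd.conj`-stable, acting trivially on every level —
the restriction `H¹(K, E_K[p]) → H¹(Γ_F ∩ Γ_{K(μ_{p^∞})}, E_K[p])` is injective (finite layers by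
Lawson–Wuthrich/Howard Lemma 2.6.2, the limit by compactness of `Γ_K`, `K(E[p^n]) ⊇ μ_{p^n}` by the Weil pairing).
This is the hypothesis `h2` of `WeierstrassCurve.eisensteinDVRSettingTame_satisfiesH_of`.
[cite: Howard2004HeegnerKolyvagin, §1.3 H.2 (arXiv p. 7, L61–63) and Lemma 2.6.2]
[cite: LawsonWuthrich2016, Lemma 3, Lemma 4] [cite: SilvermanAEC2009, Cor. III.8.1.1] -/
theorem eisensteinTower_h2Tower_of_homothety {z : absoluteGaloisGroup K} {a : ℤ}
    (hz : ∀ P : geomTorsion (W.baseChange K) (p : ℤ), z • P = a • P) (ha : ¬ (p : ℤ) ∣ a - 1)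
    (hconj : ∀ g ∈ κ.kerSubgroup, cd.conj g ∈ κ.kerSubgroup) :
    letI := IwasawaAlgebra.isLocalRing_quotient_X_pow_add_C p hm
    (W.eisensteinTower κ hm).H2Tower p cd ((W.baseChange K).torsionGaloisModule (p : ℤ)) := by
  letI := IwasawaAlgebra.isLocalRing_quotient_X_pow_add_C p hm
  haveI := normal_iInf_torsionFixing_inf_kerSubgroup W κ (p := p)
  have hp0 : ((p : ℕ) : ℤ) ≠ 0 := Int.natCast_ne_zero.mpr hp.out.ne_zero
  refine ⟨(⨅ N : ℕ, torsionFixing (W.baseChange K) ((p : ℤ) ^ (N + 1))) ⊓ κ.kerSubgroup, inferInstance,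
    isClosed_iInf_torsionFixing_inf_kerSubgroup W κ, fun g hg ↦ ?_, fun k g hg x ↦ ?_, fun c hc ↦ ?_⟩
  · -- `cd.conj`-stable
    rw [Subgroup.mem_inf, Subgroup.mem_iInf] at hg ⊢
    exact ⟨fun N ↦ cd.isLift.conjGalCMH_mem_torsionFixing W cd.involutive _ (hg.1 N), hconj g hg.2⟩
  · -- acts trivially on every level `E_K[p^{k+1}] ⊗ A_{m,k+1}(ψ)`
    rw [Subgroup.mem_inf, Subgroup.mem_iInf] at hg
    exact κ.eisensteinTwist_apply_eq_self_of_mem_kerSubgroup ((W.baseChange K).torsionGaloisModule _) hm (k + 1)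
      hg.2 (fun P ↦ smul_eq_of_mem_torsionFixing (W.baseChange K) _ (hg.1 k) P) x
  · -- injectivity of `res` to `Γ_F ⊓ Γ_{K(μ_{p^∞})}`
    refine DiscreteGaloisModule.resSubgroup_one_eq_zero_of_iInf_le ((W.baseChange K).torsionGaloisModule (p : ℤ))
      (fun N ↦ torsionFixing (W.baseChange K) ((p : ℤ) ^ (N + 1)) ⊓ κ.layerSubgroup N)
      (fun N N' hNN' ↦ ?_) (fun N ↦ ?_) (fun N c' hc' ↦ ?_) _ (fun g hg ↦ ?_) c hc
    · -- antitone
      obtain ⟨d, rfl⟩ := Nat.exists_eq_add_of_le hNN'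
      refine inf_le_inf ?_ (κ.layerSubgroup_antitone hNN')
      induction d with
      | zero => exact le_rfl
      | succ d ih =>
        exact (torsionFixing_pow_succ_le (W.baseChange K) (p : ℤ) (N + d + 1)).trans
          (ih (Nat.le_add_right N d))
    · -- open
      rw [Subgroup.coe_inf]
      exact (isOpen_torsionFixing (W.baseChange K) (pow_ne_zero _ hp0)).inter (κ.isOpen_layerSubgroup N)
    · -- finite-layer injectivity (Lawson–Wuthrich / Howard Lemma 2.6.2)
      obtain ⟨φ, rfl⟩ := oneCocycleClass_surjective _ c'
      have hbot := LawsonWuthrich2016.subgroupResKer_geomTorsion_prime_eq_bot_of_homothety_layer (W.baseChange K)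
        hz ha κ N N (torsionFixing (W.baseChange K) ((p : ℤ) ^ (N + 1)) ⊓ κ.layerSubgroup N)
        (by rw [Subgroup.coe_inf]
            exact (isOpen_torsionFixing (W.baseChange K) (pow_ne_zero _ hp0)).inter (κ.isOpen_layerSubgroup N))
        le_rfl
      have hmem : oneCocycleClass _ φ ∈ subgroupResKer (geomTorsion (W.baseChange K) (p : ℤ))
          (torsionFixing (W.baseChange K) ((p : ℤ) ^ (N + 1)) ⊓ κ.layerSubgroup N) := by
        change resSubgroup _ _ 1 (oneCocycleClass _ φ) = 0 at hc'
        rw [resSubgroup_oneCocycleClass, oneCocycleClass_eq_zero_iff] at hc'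
        obtain ⟨e, he⟩ := hc'
        exact (oneCocycleClass_mem_subgroupResKer_iff _ φ).mpr ⟨e, fun σ ↦ he σ⟩
      rw [hbot] at hmem
      exact AddSubgroup.mem_bot.mp hmem
    · -- `⋂_N U_N ≤ Γ_F ⊓ ⋂_n ker μ_{p^n}`
      rw [Subgroup.mem_iInf] at hg
      have htor : ∀ n, g ∈ torsionFixing (W.baseChange K) ((p : ℤ) ^ n) := fun n ↦
        torsionFixing_pow_succ_le (W.baseChange K) (p : ℤ) n (Subgroup.mem_inf.mp (hg n)).1
      refine Subgroup.mem_inf.mpr ⟨Subgroup.mem_inf.mpr ⟨Subgroup.mem_iInf.mpr fun N ↦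
        (Subgroup.mem_inf.mp (hg N)).1, κ.mem_kerSubgroup_of_forall_mem_layerSubgroup fun N ↦
        (Subgroup.mem_inf.mp (hg N)).2⟩, Subgroup.mem_iInf.mpr fun n ↦ ?_⟩
      have hpn : ((p ^ n : ℕ) : K) ≠ 0 := by exact_mod_cast pow_ne_zero n (NeZero.ne (p : K))
      have h := torsionFixing_le_ker_mu (W.baseChange K) hpn
      rw [Nat.cast_pow] at h
      exact h (htor n)

/-! ## §3 `cd.conj`-stability of `Gal(K̄/K_∞)` for an anticyclotomic `κ` and a transported complex conjugation -/

/-- **Greenberg's «`c` acts on `Gal(K_∞/K)` by `−1`», subgroup form**: for `K` imaginary quadratic, `κ` anticyclotomic and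
`cd.τ = e c₀ e⁻¹` a transported complex conjugation `c₀ ∈ Γ_ℚ`, conjugation by `τ` preserves `Gal(K̄/K_∞) = ker κ`
(`res(τ⁻¹ g τ) = c₀ · res g · c₀⁻¹` with `c₀ ∉ res Γ_K`, so `κ(τ⁻¹ g τ) = κ(g)⁻¹`).
[cite: Greenberg1987, §2] [cite: Howard2004HeegnerKolyvagin, §1.3 (arXiv p. 7, L33–41)] -/
theorem conj_mem_kerSubgroup_of_isAnticyclotomic (hK : IsImaginaryQuadratic K) (hanti : κ.IsAnticyclotomic)
    {c₀ : absoluteGaloisGroup ℚ} (hc₀ : IsComplexConjugation (Rat.castHom ℝ) c₀)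
    (hτ : ∀ x, cd.τ x = absGaloisTransport (K := ℚ) (L := K) c₀ x)
    {g : absoluteGaloisGroup K} (hg : g ∈ κ.kerSubgroup) : cd.conj g ∈ κ.kerSubgroup := by
  haveI : IsTotallyComplex K := hK.2
  have hτeq : cd.τ = (absGaloisTransport (K := ℚ) (L := K) c₀).toRingEquiv := RingEquiv.ext hτ
  have ht : IsLiftOfAut cd.σ (absGaloisTransport (K := ℚ) (L := K) c₀).toRingEquiv := fun x ↦ by
    rw [← hτeq]; exact cd.isLift x
  -- `cd.conj g` is `ht.conjGalCMH g` (both are `τ⁻¹ g τ` for the same underlying `τ`)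
  have hconj : cd.conj g = ht.conjGalCMH g := by
    apply AlgEquiv.ext
    intro x
    change cd.τ.symm ((show AlgebraicClosure K ≃ₐ[K] AlgebraicClosure K from g) (cd.τ x)) =
      (absGaloisTransport (K := ℚ) (L := K) c₀).toRingEquiv.symm
        ((show AlgebraicClosure K ≃ₐ[K] AlgebraicClosure K from g)
          ((absGaloisTransport (K := ℚ) (L := K) c₀).toRingEquiv x))
    rw [hτeq]
  -- `res (τ⁻¹ g τ) = c₀ · res g · c₀⁻¹`
  have hsq := sq_eq_absGaloisRestrict_conjGal_mul hc₀ ht g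
  rw [map_mul, pow_two] at hsq
  have hres : absGaloisRestrict ℚ K (cd.conj g) = c₀ * absGaloisRestrict ℚ K g * c₀⁻¹ := by
    have hc2 : c₀ * c₀ = 1 := by rw [← pow_two]; exact hc₀.sq_eq_one
    have hinv : c₀⁻¹ = c₀ := inv_eq_of_mul_eq_one_right hc2
    rw [hconj, hinv]
    exact (mul_right_cancel hsq.symm)
  have hc₀K : c₀ ∉ Set.range (absGaloisRestrict ℚ K) :=
    hc₀.not_mem_range_absGaloisRestrict (L := K) fun w ↦ IsTotallyComplex.isComplex w
  rw [ZpExtension.mem_kerSubgroup] at hg ⊢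
  rw [hanti g (cd.conj g) c₀ hc₀K hres, hg, inv_one]

/-- **Howard's H.2 (`H2Tower`) for the Eisenstein tower of `E_K` on the frames of the shared μ-crux**: `K` imaginary
quadratic, `κ` ANTICYCLOTOMIC, `cd.τ` a transported complex conjugation (as for `h5a`), and one homothety `z ≡ a` on
`E_K[p]` with `p ∤ a − 1` (on the crux's frames: `exists_smul_eq_zsmul_of_thm413Hypotheses`, Serre/Gross) — the hypothesis
`h2` of `WeierstrassCurve.eisensteinDVRSettingTame_satisfiesH_of`.
[cite: Howard2004HeegnerKolyvagin, §1.3 H.2 (arXiv p. 7, L61–63) and Lemma 2.6.2] [cite: LawsonWuthrich2016, Lemma 3, Lemma 4]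
[cite: Greenberg1987, §2] -/
theorem eisensteinTower_h2Tower (κ₀ : ZpExtension K p) (hker : κ.kerSubgroup = κ₀.kerSubgroup)
    (hK : IsImaginaryQuadratic K) (hanti : κ₀.IsAnticyclotomic)
    {c₀ : absoluteGaloisGroup ℚ} (hc₀ : IsComplexConjugation (Rat.castHom ℝ) c₀)
    (hτ : ∀ x, cd.τ x = absGaloisTransport (K := ℚ) (L := K) c₀ x)
    {z : absoluteGaloisGroup K} {a : ℤ}
    (hz : ∀ P : geomTorsion (W.baseChange K) (p : ℤ), z • P = a • P) (ha : ¬ (p : ℤ) ∣ a - 1) :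
    letI := IwasawaAlgebra.isLocalRing_quotient_X_pow_add_C p hm
    (W.eisensteinTower κ hm).H2Tower p cd ((W.baseChange K).torsionGaloisModule (p : ℤ)) :=
  W.eisensteinTower_h2Tower_of_homothety κ hm cd hz ha fun _ hg ↦ by
    rw [hker] at hg ⊢
    exact conj_mem_kerSubgroup_of_isAnticyclotomic κ₀ cd hK hanti hc₀ hτ hg

/-- **The same for the tower at a unit twist `κ.unitTwist u`** of the anticyclotomic `κ` (the shared μ-crux builds
`eisensteinDVRSetting` at `κ⁻ = κ.unitTwist (-1)`; `Gal(K̄/K_∞)` is unchanged, `ZpExtension.kerSubgroup_unitTwist`).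
[cite: Howard2004HeegnerKolyvagin, §1.3 H.2 (arXiv p. 7, L61–63)] [cite: Greenberg1987, §2] -/
theorem eisensteinTower_unitTwist_h2Tower (u : ℤ_[p]ˣ) (hK : IsImaginaryQuadratic K) (hanti : κ.IsAnticyclotomic)
    {c₀ : absoluteGaloisGroup ℚ} (hc₀ : IsComplexConjugation (Rat.castHom ℝ) c₀)
    (hτ : ∀ x, cd.τ x = absGaloisTransport (K := ℚ) (L := K) c₀ x)
    {z : absoluteGaloisGroup K} {a : ℤ}
    (hz : ∀ P : geomTorsion (W.baseChange K) (p : ℤ), z • P = a • P) (ha : ¬ (p : ℤ) ∣ a - 1) :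
    letI := IwasawaAlgebra.isLocalRing_quotient_X_pow_add_C p hm
    (W.eisensteinTower (κ.unitTwist u) hm).H2Tower p cd ((W.baseChange K).torsionGaloisModule (p : ℤ)) :=
  W.eisensteinTower_h2Tower (κ.unitTwist u) hm cd κ (κ.kerSubgroup_unitTwist u) hK hanti hc₀ hτ hz ha

end H2

end WeierstrassCurve

end
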